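import Literature.Analysis.FluidPDE.NSFourierSobolev
import Literature.Analysis.FluidPDE.NSFourierAPriori
import Literature.Analysis.FluidPDE.EnstrophySplitting
import HarnessLib

/-!
# A priori control of the Fourier-side weights by energy and `L²_t H²_x` dissipation

Continuation-argument companion to the Fourier-side (pseudo-measure) construction of Leray's
local regular solution (`NSFourierPicard`, `NSFourierMild`, `NSFourierAPriori`,
`NSFourierRestart`, `NSFourierSobolev`). `NSFourierAPriori` shows that the weighted sup-norms of
a Fourier-side mild solution `V` on `[t₀, t₁]` (`IsFourierMild c K₀ t₀ t₁ V`) at most double over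
a time window on which the `L²_t L¹_ξ` mass `∫ₛᵗ (∫ ‖V(r, η)‖ dη)² dr` is small
(`IsFourierMild.hasDecay_of_window`, `…hasDecay_uniform`), and bounds that mass by the energy
`sup_r ∫ ‖V(r)‖²` and the dissipation `𝒟(V; s, t) = ∫ₛᵗ ∫ ‖ξ‖⁴ ‖V‖²` of the window
(`IsFourierMild.mass_sq_integral_le`); there the dissipation is in turn controlled under an
`L^∞` bound on the synthesized velocity (`IsFourierMild.dissip_le`).

This file provides the **`L^∞`-free** closing of that argument, for use along solutions which
are only known to be continuous into `L³` (von Wahl's class; `EnstrophySplittingDissipation`):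

* `FourierNS.exists_window_of_energy_dissip` — given the energy level `Λ` and a bound `D` for
  the *total* dissipation `𝒟(V; t₀, t₁)`, there is a window length `τ = τ(ι, c, K, Λ, D) > 0`,
  **independent of the solution and of the length of the interval**, such that every Fourier-side
  mild solution with these bounds has `HasDecay K (2^{⌈(t₁-t₀)/τ⌉} A₀) (V r)` on `[t₀, t₁]`
  (`A₀` the weight of `V(t₀)`): choose `ρ` with small tail mass (`exists_tailMass_le`) against
  `D`, then `τ` against `|B_ρ| Λ`.
* the Plancherel dictionary feeding it from the physical side when the slices are syntheses
  `u(r) = synthVel (V r)` of a classical solution: `∫ ‖V(r)‖² ≤ ∫ ‖u(r)‖²`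
  (`lintegral_enorm_sq_le_of_synthVel`) and
  `𝒟(V; s, t) ≤ (2π)⁻⁴ ∫ₛᵗ ∫ ‖Δu(r)‖²` (`IsFourierMild.dissip_le_of_synthVel`), through the
  coordinate-tensor Plancherel identity of `NSFourierSobolev` (`m = 2`) and the Hessian–Laplacian
  identity `∫ |∇²v|² = ∫ ‖Δv‖²` (`integral_levelSq_two_eq_integral_laplacian_sq`, from
  `EnstrophySplitting.sum_sum_integral_sq_norm_fderiv_fderiv_eq_integral_sq_norm_laplacian`).

No definition is introduced.

## References

* J. Leray, Acta Math. 63 (1934), §§19–21 (restart of the regular solution). [Leray1934]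
* P. G. Lemarié-Rieusset, *The Navier–Stokes Problem in the 21st Century*, CRC 2016, Thm. 7.2
  (restart for mild solutions), Thm. 11.2 (the `L²Ḣ²` dissipation), Prop. 12.3 (von Wahl).
-/

noncomputable section

open MeasureTheory Real Set Filter Topology Function Complex FourierTransform InnerProductSpace
open scoped FourierTransform RealInnerProductSpace ENNReal NNReal ContDiff ComplexConjugate Laplacian

namespace Literature.Analysis.FluidPDE

/-! ### `|∇²v|² = Σⱼ Σᵢ ‖∂ᵢ∂ⱼ v‖²` and the Hessian–Laplacian identity for `levelSq 2` -/

section LevelTwo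

/-- **The coordinate tensor of order two**: `|∇²v|²(x) = Σⱼ Σᵢ ‖∂ᵢ(∂ⱼ v)(x)‖²` for a `C²`
vector field on `ℝ³` (`levelSq_succ_eq`, `(D(∂ⱼv) eᵢ)ₗ = ∂ᵢ∂ⱼvₗ`). [folklore] -/
theorem levelSq_two_eq_sum_sum_norm_sq {v : EuclideanSpace ℝ (Fin 3) → EuclideanSpace ℝ (Fin 3)}
    (hv : ContDiff ℝ 2 v) (x : EuclideanSpace ℝ (Fin 3)) :
    levelSq 2 v x = ∑ j, ∑ i, ‖fderiv ℝ (fun y => fderiv ℝ v y (EuclideanSpace.basisFun (Fin 3) ℝ j)) x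
      (EuclideanSpace.basisFun (Fin 3) ℝ i)‖ ^ 2 := by
  set e := EuclideanSpace.basisFun (Fin 3) ℝ with he
  have hv1 : ContDiff ℝ 1 v := hv.of_le (by norm_num)
  have hdv : ∀ y, DifferentiableAt ℝ v y := fun y => hv1.differentiable one_ne_zero y
  have hdw : ∀ j, DifferentiableAt ℝ (fun y => fderiv ℝ v y (e j)) x := fun j =>
    (((hv.fderiv_right (m := 1) le_rfl).clm_apply contDiff_const).differentiable one_ne_zero) x
  -- components of `D(∂ⱼv)(x) eᵢ`
  have hcomp : ∀ j i l, fderiv ℝ (fun y => fderiv ℝ v y (e j)) x (e i) l =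
      pderiv i (pderiv j fun y => v y l) x := by
    intro j i l
    have hFG : (fun y => fderiv ℝ v y (e j) l) = pderiv j (fun y => v y l) := by
      funext y
      rw [euclidean_fderiv_apply_comp (hdv y), pderiv_apply, stdVec_eq_basisFun]
    rw [euclidean_fderiv_apply_comp (hdw j), hFG, pderiv_apply i, stdVec_eq_basisFun]
  rw [levelSq_succ_eq, Fintype.sum_equiv (Equiv.funUnique (Fin 1) (Fin 3))
    (fun β : Fin 1 → Fin 3 => ∑ k, ∑ i, pderiv k (ipderiv β fun y => v y i) x ^ 2)
    (fun j => ∑ k, ∑ i, pderiv k (pderiv j fun y => v y i) x ^ 2)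
    (fun β => by
      refine Finset.sum_congr rfl fun k _ => Finset.sum_congr rfl fun i _ => ?_
      rw [ipderiv_succ, ipderiv_zero]
      rfl)]
  refine Finset.sum_congr rfl fun j _ => Finset.sum_congr rfl fun i _ => ?_
  rw [EuclideanSpace.real_norm_sq_eq]
  exact Finset.sum_congr rfl fun l _ => by rw [hcomp j i l]

/-- Mixed second partials are bounded by the second derivative:
`‖∂ᵢ(∂ⱼ v)(x)‖ ≤ ‖D²v(x)‖` for unit basis vectors. [folklore] -/
theorem norm_fderiv_fderiv_apply_basisFun_le' {F : Type*} [NormedAddCommGroup F] [NormedSpace ℝ F]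
    {v : EuclideanSpace ℝ (Fin 3) → F} (hv : ContDiff ℝ 2 v) (x : EuclideanSpace ℝ (Fin 3))
    (j i : Fin 3) :
    ‖fderiv ℝ (fun y => fderiv ℝ v y (EuclideanSpace.basisFun (Fin 3) ℝ j)) x
      (EuclideanSpace.basisFun (Fin 3) ℝ i)‖ ≤ ‖iteratedFDeriv ℝ 2 v x‖ := by
  set e := EuclideanSpace.basisFun (Fin 3) ℝ with he
  have he1 : ∀ i, ‖e i‖ = 1 := fun i => by simp [he]
  have hd : DifferentiableAt ℝ (fderiv ℝ v) x :=
    ((hv.fderiv_right (m := 1) le_rfl).differentiable one_ne_zero) x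
  have h2 : fderiv ℝ (fderiv ℝ v) x (e i) (e j) = iteratedFDeriv ℝ 2 v x ![e i, e j] := by
    rw [iteratedFDeriv_two_apply]
    simp
  rw [FluidPDE.fderiv_apply_const_apply hd, h2]
  refine (ContinuousMultilinearMap.le_opNorm _ _).trans ?_
  rw [Fin.prod_univ_two]
  simp [he1]

/-- **The Hessian–Laplacian identity for the coordinate tensor**: `∫ |∇²v|² = ∫ ‖Δv‖²` for a
`C³` field on `ℝ³` with `D¹v, D²v, D³v ∈ L²` (`levelSq_two_eq_sum_sum_norm_sq` and the tree's
`sum_sum_integral_sq_norm_fderiv_fderiv_eq_integral_sq_norm_laplacian`; Stein 1970, Ch. III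
§1.3). [folklore] -/
theorem integral_levelSq_two_eq_integral_laplacian_sq
    {v : EuclideanSpace ℝ (Fin 3) → EuclideanSpace ℝ (Fin 3)} (hv : ContDiff ℝ 3 v)
    (hv1 : ∫⁻ x, ‖iteratedFDeriv ℝ 1 v x‖ₑ ^ 2 < ⊤) (hv2 : ∫⁻ x, ‖iteratedFDeriv ℝ 2 v x‖ₑ ^ 2 < ⊤)
    (hv3 : ∫⁻ x, ‖iteratedFDeriv ℝ 3 v x‖ₑ ^ 2 < ⊤) :
    ∫ x, levelSq 2 v x = ∫ x, ‖(Δ v) x‖ ^ 2 := by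
  set e := EuclideanSpace.basisFun (Fin 3) ℝ with he
  have hv2' : ContDiff ℝ 2 v := hv.of_le (by norm_num)
  have hint : ∀ j i, Integrable (fun x => ‖fderiv ℝ (fun y => fderiv ℝ v y (e j)) x (e i)‖ ^ 2)
      volume := by
    intro j i
    have hc : Continuous fun x => fderiv ℝ (fun y => fderiv ℝ v y (e j)) x (e i) :=
      ((((hv.fderiv_right (m := 2) (by norm_num)).clm_apply contDiff_const).continuous_fderiv
        (by norm_num)).clm_apply continuous_const)
    exact FluidPDE.integrable_sq_norm_of_lintegral_lt_top hc
      (lintegral_enorm_sq_lt_top_of_norm_le (fun x => norm_fderiv_fderiv_apply_basisFun_le' hv2' x j i)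
        hv2)
  rw [← sum_sum_integral_sq_norm_fderiv_fderiv_eq_integral_sq_norm_laplacian hv hv1 hv2 hv3,
    integral_congr_ae (Eventually.of_forall fun x => levelSq_two_eq_sum_sum_norm_sq hv2' x),
    integral_finsetSum _ fun j _ => integrable_finsetSum _ fun i _ => hint j i]
  exact Finset.sum_congr rfl fun j _ => integral_finsetSum _ fun i _ => hint j i

/-- Lower-integral form: `∫⁻ ofReal |∇²v|² = ∫⁻ ‖Δv‖ₑ²` under the same hypotheses. [folklore] -/
theorem lintegral_levelSq_two_eq_lintegral_laplacian_sq
    {v : EuclideanSpace ℝ (Fin 3) → EuclideanSpace ℝ (Fin 3)} (hv : ContDiff ℝ ∞ v)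
    (hv1 : ∫⁻ x, ‖iteratedFDeriv ℝ 1 v x‖ₑ ^ 2 < ⊤) (hv2 : ∫⁻ x, ‖iteratedFDeriv ℝ 2 v x‖ₑ ^ 2 < ⊤)
    (hv3 : ∫⁻ x, ‖iteratedFDeriv ℝ 3 v x‖ₑ ^ 2 < ⊤) :
    ∫⁻ x, ENNReal.ofReal (levelSq 2 v x) = ∫⁻ x, ‖(Δ v) x‖ₑ ^ 2 := by
  have hv3' : ContDiff ℝ 3 v := hv.of_le (by norm_cast)
  have hv2' : ContDiff ℝ 2 v := hv.of_le (by norm_cast)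
  obtain ⟨hLint, -⟩ := integrable_levelSq_of_lintegral_lt_top hv 2 hv2
  have hΔint : Integrable (fun x => ‖(Δ v) x‖ ^ 2) volume := by
    have n_Δ : ∀ x, ‖(Δ v) x‖ ≤ ‖(3 : ℝ) • iteratedFDeriv ℝ 2 v x‖ := fun x => by
      rw [norm_smul, Real.norm_of_nonneg (by norm_num : (0 : ℝ) ≤ 3)]
      exact norm_laplacian_le_three_mul_norm_iteratedFDeriv_two hv2' x
    refine FluidPDE.integrable_sq_norm_of_lintegral_lt_top
      (contDiff_one_laplacian_of_contDiff_three hv3').continuous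
      (lintegral_enorm_sq_lt_top_of_norm_le n_Δ ?_)
    have : ∀ x, ‖(3 : ℝ) • iteratedFDeriv ℝ 2 v x‖ₑ ^ 2 =
        ENNReal.ofReal (3 ^ 2) * ‖iteratedFDeriv ℝ 2 v x‖ₑ ^ 2 := by
      intro x
      rw [enorm_smul, mul_pow, Real.enorm_eq_ofReal (by norm_num : (0:ℝ) ≤ 3),
        ENNReal.ofReal_pow (by norm_num : (0:ℝ) ≤ 3)]
    simp_rw [this]
    rw [lintegral_const_mul' _ _ ENNReal.ofReal_ne_top]
    exact ENNReal.mul_lt_top ENNReal.ofReal_lt_top hv2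
  rw [← ofReal_integral_eq_lintegral_ofReal hLint (Eventually.of_forall fun x => levelSq_nonneg _ _ _),
    integral_levelSq_two_eq_integral_laplacian_sq hv3' hv1 hv2 hv3,
    ofReal_integral_eq_lintegral_ofReal hΔint (Eventually.of_forall fun x => sq_nonneg _)]
  refine lintegral_congr fun x => ?_
  rw [ENNReal.ofReal_pow (norm_nonneg _), ofReal_norm]

end LevelTwo

end Literature.Analysis.FluidPDE

namespace Literature.Analysis.FluidPDE.FourierNS

variable {ι : Type*} [Fintype ι] [DecidableEq ι]

/-! ### Energy and dissipation of syntheses (Plancherel) -/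

section Plancherel

/-- **The Fourier-side energy is at most the physical energy**: for a continuous, polynomially
decaying, conjugation-symmetric coefficient field, `∫ ‖V₀(η)‖² dη ≤ ∫ ‖synthVel V₀ (x)‖² dx`
(Plancherel `∫ Σₗ ‖V₀ₗ‖² = ∫ ‖synthVel V₀‖²` of `NSFourierSobolev` and `‖z‖² ≤ Σₗ ‖zₗ‖²` for the
sup norm on `ι → ℂ`). [folklore] -/
theorem lintegral_enorm_sq_le_of_synthVel (V₀ : EuclideanSpace ℝ ι → ι → ℂ) (hc : Continuous V₀)
    (hdec : ∀ K : ℕ, ∃ B, HasDecay K B V₀) (hconj : ∀ ξ l, V₀ (-ξ) l = conj (V₀ ξ l)) :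
    ∫⁻ η, ‖V₀ η‖ₑ ^ 2 ≤ ∫⁻ x, ‖synthVel V₀ x‖ₑ ^ 2 := by
  rw [lintegral_norm_synthVel_sq_eq V₀ hc hdec hconj]
  exact lintegral_mono fun η => enorm_sq_le_sum_enorm_sq (V₀ η)

/-- **The Fourier-side `Ḣ²` density is at most `(2π)⁻⁴ ∫ |∇² synthVel V₀|²`** (Plancherel for
the coordinate tensor of order two, `lintegral_levelSq_synthVel_eq`, and `‖z‖² ≤ Σₗ ‖zₗ‖²`). [folklore] -/
theorem lintegral_weight_four_le_of_synthVel (V₀ : EuclideanSpace ℝ ι → ι → ℂ) (hc : Continuous V₀)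
    (hdec : ∀ K : ℕ, ∃ B, HasDecay K B V₀) (hconj : ∀ ξ l, V₀ (-ξ) l = conj (V₀ ξ l)) :
    ∫⁻ ξ, ENNReal.ofReal (‖ξ‖ ^ 4 * ‖V₀ ξ‖ ^ 2) ≤
      ENNReal.ofReal (((2 * π) ^ 4)⁻¹) * ∫⁻ x, ENNReal.ofReal (levelSq 2 (synthVel V₀) x) := by
  have h := lintegral_levelSq_synthVel_eq V₀ hc hdec hconj 2
  have hpos : 0 < (2 * π) ^ 4 := by positivity
  rw [h, ← mul_assoc, ← ENNReal.ofReal_mul (inv_nonneg.2 hpos.le),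
    show (2 * 2 : ℕ) = 4 from rfl, inv_mul_cancel₀ hpos.ne', ENNReal.ofReal_one, one_mul]
  refine lintegral_mono fun ξ => ?_
  rw [ENNReal.ofReal_mul (by positivity), ENNReal.ofReal_pow (norm_nonneg (V₀ ξ)), ofReal_norm]
  gcongr
  exact enorm_sq_le_sum_enorm_sq (V₀ ξ)

end Plancherel

/-! ### Dissipation of a mild solution whose slices are syntheses of a smooth solution -/

section Dissip

variable {c t₀ t₁ : ℝ} {K₀ : ℕ} {V : ℝ → EuclideanSpace ℝ ι → ι → ℂ}

omit [DecidableEq ι] in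
/-- The dissipation is monotone in the window. [folklore] -/
theorem dissip_mono (V : ℝ → EuclideanSpace ℝ ι → ι → ℂ) {s t s' t' : ℝ} (hs : s' ≤ s)
    (ht : t ≤ t') : dissip V s t ≤ dissip V s' t' :=
  lintegral_mono_set (Ioc_subset_Ioc hs ht)

/-- **Dissipation through the physical side.** Let `V` be a Fourier-side mild solution on
`[t₀, t₁]` (in dimension three) whose slices are the Fourier coefficients of the slices of a
smooth velocity field, `u(r) = synthVel (V r)` on `[t₀, t₁]`, with `D¹u, D²u, D³u ∈ L²` at every
time. Then for every window `[s, t] ⊆ [t₀, t₁]`,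
`𝒟(V; s, t) ≤ (2π)⁻⁴ ∫ₛᵗ ∫ ‖Δu(r)‖² dr` (Plancherel for `|∇²u|²` and `∫ |∇²u|² = ∫ ‖Δu‖²`). [folklore] -/
theorem IsFourierMild.dissip_le_of_synthVel {V : ℝ → EuclideanSpace ℝ (Fin 3) → Fin 3 → ℂ}
    (h : IsFourierMild c K₀ t₀ t₁ V)
    {u : ℝ → EuclideanSpace ℝ (Fin 3) → EuclideanSpace ℝ (Fin 3)}
    (hu : ∀ r ∈ Icc t₀ t₁, u r = synthVel (V r)) (hsm : ∀ r ∈ Icc t₀ t₁, ContDiff ℝ ∞ (u r))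
    (h1 : ∀ r ∈ Icc t₀ t₁, ∫⁻ x, ‖iteratedFDeriv ℝ 1 (u r) x‖ₑ ^ 2 < ⊤)
    (h2 : ∀ r ∈ Icc t₀ t₁, ∫⁻ x, ‖iteratedFDeriv ℝ 2 (u r) x‖ₑ ^ 2 < ⊤)
    (h3 : ∀ r ∈ Icc t₀ t₁, ∫⁻ x, ‖iteratedFDeriv ℝ 3 (u r) x‖ₑ ^ 2 < ⊤)
    {s t : ℝ} (hs : t₀ ≤ s) (ht : t ≤ t₁) :
    dissip V s t ≤ ENNReal.ofReal (((2 * π) ^ 4)⁻¹) * ∫⁻ r in Ioc s t, ∫⁻ x, ‖(Δ (u r)) x‖ₑ ^ 2 := by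
  have hslice : ∀ r ∈ Ioc s t, ∫⁻ ξ, ENNReal.ofReal (‖ξ‖ ^ 4 * ‖V r ξ‖ ^ 2) ≤
      ENNReal.ofReal (((2 * π) ^ 4)⁻¹) * ∫⁻ x, ‖(Δ (u r)) x‖ₑ ^ 2 := by
    intro r hr
    have hrI : r ∈ Icc t₀ t₁ := ⟨hs.trans hr.1.le, hr.2.trans ht⟩
    have hdec : ∀ K : ℕ, ∃ B, HasDecay K B (V r) := fun K => by
      obtain ⟨A, hA⟩ := h.decay K
      exact ⟨A, hA r⟩
    refine (lintegral_weight_four_le_of_synthVel (V r) (h.continuous_slice r) hdec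
      (fun ξ l => h.conjSymm r ξ l)).trans (le_of_eq ?_)
    rw [← hu r hrI, lintegral_levelSq_two_eq_lintegral_laplacian_sq (hsm r hrI) (h1 r hrI) (h2 r hrI)
      (h3 r hrI)]
  have hmono : dissip V s t ≤
      ∫⁻ r in Ioc s t, ENNReal.ofReal (((2 * π) ^ 4)⁻¹) * ∫⁻ x, ‖(Δ (u r)) x‖ₑ ^ 2 :=
    setLIntegral_mono' measurableSet_Ioc hslice
  rwa [lintegral_const_mul' _ _ ENNReal.ofReal_ne_top] at hmono

end Dissip

/-! ### Uniform weights from energy and total dissipation -/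

section Window

variable {c : ℝ}

/-- **Uniform Fourier-side weights from energy and total dissipation.** In dimension
`card ι < 4`, for a heat rate `c > 0`, an order `K`, an energy level `Λ ≥ 0` and a dissipation
budget `D ≥ 0` there is a window length `τ > 0` — depending on these numbers only — such that:
for every Fourier-side mild solution `V` on `[t₀, t₁]` (rate `c`) with `∫ ‖V(r)‖² ≤ Λ` on
`[t₀, t₁]` and total dissipation `𝒟(V; t₀, t₁) ≤ D`, and every order-`K` weight `A₀` of
`V(t₀)`, all slices obey `HasDecay K (2^{⌈(t₁ - t₀)/τ⌉} A₀) (V r)`, `r ∈ [t₀, t₁]`.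
Proof: by `IsFourierMild.mass_sq_integral_le` the `L²_t L¹_ξ` mass of a window of length `≤ τ`
is at most `G = 2|B_ρ| Λ τ + 2 tailMass(ρ) D`; choosing first `ρ` with
`2 tailMass(ρ) D · C_K² ≤ c/4` (`exists_tailMass_le`) and then `τ` with `2|B_ρ| Λ τ · C_K² ≤ c/4`
gives `C_K² G ≤ c/2`, the smallness required by `IsFourierMild.hasDecay_uniform` (doubling of
the weights on each window; Leray 1934, §21). [folklore] -/
theorem exists_window_of_energy_dissip (hι : Fintype.card ι < 4) (hc : 0 < c) (K : ℕ)
    {Λ D : ℝ} (hΛ0 : 0 ≤ Λ) (hD0 : 0 ≤ D) :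
    ∃ τ : ℝ, 0 < τ ∧ ∀ {K₀ : ℕ} {t₀ t₁ : ℝ} {V : ℝ → EuclideanSpace ℝ ι → ι → ℂ},
      IsFourierMild c K₀ t₀ t₁ V →
      (∀ r ∈ Icc t₀ t₁, ∫⁻ η, ‖V r η‖ₑ ^ 2 ≤ ENNReal.ofReal Λ) →
      dissip V t₀ t₁ ≤ ENNReal.ofReal D →
      ∀ {A₀ : ℝ}, HasDecay K A₀ (V t₀) →
        ∀ r ∈ Icc t₀ t₁, HasDecay K (2 ^ ⌈(t₁ - t₀) / τ⌉₊ * A₀) (V r) := by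
  set C : ℝ := decayWindowConst ι K with hC
  have hC0 : 0 ≤ C := decayWindowConst_nonneg (ι := ι) K
  -- the tail radius
  obtain ⟨ρ, hρ1, hρ⟩ := exists_tailMass_le (ι := ι) hι
    (ε := c / (8 * (C ^ 2 + 1) * (D + 1))) (by positivity)
  set vB : ℝ := (volume (Metric.closedBall (0 : EuclideanSpace ℝ ι) ρ)).toReal with hvB
  have hvB0 : 0 ≤ vB := ENNReal.toReal_nonneg
  -- the window length
  set τ : ℝ := c / (8 * (C ^ 2 + 1) * (vB * Λ + 1)) with hτ
  have hτ0 : 0 < τ := by positivity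
  refine ⟨τ, hτ0, ?_⟩
  intro K₀ t₀ t₁ V h hE hD A₀ hA
  set G : ℝ := 2 * vB * Λ * τ + 2 * tailMass ι ρ * D with hG
  have htm0 := tailMass_nonneg (ι := ι) ρ
  -- smallness of the window mass bound
  have hsmall : C ^ 2 * G ≤ c / 2 := by
    have h1 : C ^ 2 * (2 * vB * Λ * τ) ≤ c / 4 := by
      have hle : C ^ 2 * (2 * vB * Λ) ≤ 2 * (C ^ 2 + 1) * (vB * Λ + 1) := by
        nlinarith [mul_nonneg hvB0 hΛ0, sq_nonneg C]
      calc C ^ 2 * (2 * vB * Λ * τ) = C ^ 2 * (2 * vB * Λ) * τ := by ring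
        _ ≤ 2 * (C ^ 2 + 1) * (vB * Λ + 1) * τ := mul_le_mul_of_nonneg_right hle hτ0.le
        _ = c / 4 := by rw [hτ]; field_simp; ring
    have h2 : C ^ 2 * (2 * tailMass ι ρ * D) ≤ c / 4 := by
      have hle : C ^ 2 * (2 * D) ≤ 2 * (C ^ 2 + 1) * (D + 1) := by
        nlinarith [hD0, sq_nonneg C]
      calc C ^ 2 * (2 * tailMass ι ρ * D) = C ^ 2 * (2 * D) * tailMass ι ρ := by ring
        _ ≤ 2 * (C ^ 2 + 1) * (D + 1) * (c / (8 * (C ^ 2 + 1) * (D + 1))) :=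
            mul_le_mul hle hρ htm0 (by positivity)
        _ = c / 4 := by field_simp; ring
    calc C ^ 2 * G = C ^ 2 * (2 * vB * Λ * τ) + C ^ 2 * (2 * tailMass ι ρ * D) := by rw [hG]; ring
      _ ≤ c / 4 + c / 4 := add_le_add h1 h2
      _ = c / 2 := by ring
  -- the window hypothesis
  have hwin : ∀ s ∈ Icc t₀ t₁, ∀ t ∈ Icc s t₁, t - s ≤ τ → ∫ r in s..t, (∫ η, ‖V r η‖) ^ 2 ≤ G := by
    intro s hsI t htI hts
    have hDst : dissip V s t ≤ ENNReal.ofReal D := (dissip_mono V hsI.1 htI.2).trans hD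
    have hm := h.mass_sq_integral_le hι hΛ0 hE hsI.1 htI.1 htI.2 hρ1 hD0 hDst
    refine hm.trans ?_
    rw [hG]
    have : 2 * vB * Λ * (t - s) ≤ 2 * vB * Λ * τ :=
      mul_le_mul_of_nonneg_left hts (by positivity)
    linarith
  exact h.hasDecay_uniform hA hτ0 hwin hsmall

end Window

end Literature.Analysis.FluidPDE.FourierNS

end
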